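import Summits.HubbardSuperconductivity.HubbardSuperconductivity.Theorems.SoloInformedPseudospinPairBound
import HarnessLib

/-!
# Pseudospin bound on the pair field of `η`-lowest-weight sector ground states, II: the torus and the summit's format

Soloist `solo-HubbardSuperconductivity-informed` (family `hubbard`), necessary condition N15 of
the sharpest-statement paper, §10, continued from `SoloInformedPseudospinPairBound` (Part I: the
kinematic triplet bound `‖Δ_w ψ‖² ≤ ((|Λ| + 2 - N)/4) ‖J_w ψ‖²` for `η`-lowest-weight `N`-particle
vectors and its ground-state version under the two-hole sector gap criterion).

* `pairField_eq_weightedPair` — for a form factor with `g 0 = 0` (e.g. `dWaveFormFactor`) the pair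
  field `Δ_g = pairField g L` of `PairCorrelations` is the weighted bond pair field over the bonds
  `(x, x + e)`, `e ∈ unitSteps`, weights `g e/√2`; `torusStagger_ofTorusSite_add` — on the torus of
  even side these bonds join opposite staggered signs `ε_x = (-1)^{x₁+x₂}`.
* `re_expect_pairField_le_of_isGroundStateInSector` — **torus / `g`-wave specialisation**: a
  ground state of `hubbardTorus 2 L t U` (even `L`) in the sector `(N, S)` with `2 ≤ N ≤ L² + 2` and
  `E₀(N, S) - U < E₀(N - 2, S)` obeys
  `Re ⟨ψ, Δ_g† Δ_g ψ⟩ ≤ ((L² + 2 - N)/4) · Re ⟨J_g ψ, J_g ψ⟩`,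
  `J_g = Σ_x Σ_{e ∈ unitSteps} (g e/√2) ε_x j_{x, x+e}` the staggered `g`-wave bond current
  (for `g = dWaveFormFactor`: the staggered `d`-density-wave / orbital-antiferromagnet current of
  Markiewicz–Vaughn).
* `eventually_sq_le_staggeredCurrent_of_pairField_lro` — **the summit's format**: under the
  summit's hypotheses on `(N, ψ)` (hole density `0 < δ < 1`, sector ground states at `S^z = 0`,
  `N L = 2⌊(1-δ)L²/2⌋`), the two-hole sector gap criterion at all large even `L`, and the summit's
  conclusion `HasLongRangeOrder` for the `g`-wave pair field, there is `c > 0` with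
  `c L² ≤ Re ⟨J_g ψ_L, J_g ψ_L⟩` for all large even `L`.

## Consequence for the summit (informal; paper §10, N15)

In the summit's setting (`U > 0`, `S^z = 0`, `N_L = 2⌊(1-δ)L²/2⌋`, so `(L² + 2 - N_L)/4 ≤ δL²/4 + 1`)
any witness family whose sector ground states are `η`-lowest-weight (which holds whenever the
two-hole sector gap criterion is met — the expected situation at `U > 0` below half filling, where
`η`-raised states cost energy `U`) must carry staggered `d`-current fluctuations
`L⁻² Re⟨J_d ψ_L, J_d ψ_L⟩ ≥ (4/δ - o(1)) · L⁻⁴ Re⟨ψ_L, Δ_d† Δ_d ψ_L⟩`: `d`-wave pair long-range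
order of density `ρ` forces a `(π,π)` staggered-current structure factor `≥ 4ρ/δ`.

## Sources

S.-C. Zhang, PRL **65** (1990) 120 [cite: Zhang1990]; R. S. Markiewicz, M. T. Vaughn, J. Phys.
Chem. Solids **59** (1998) 1737, p. 3 [cite: MarkiewiczVaughn1998, p. 3]; C. N. Yang, PRL **63**
(1989) 2144, eq. (6) [cite: Yang1989, eq. (6)]; D. J. Scalapino, Phys. Rep. **250** (1995) 329, §2
(the `d`-wave pair field); F. H. L. Essler et al., *The One-Dimensional Hubbard Model* (2005) §9.3
[cite: EsslerEtAl2005, §9.3] (nearest prior art: `η`-selection rules at half filling).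
-/

namespace Summit.HubbardSuperconductivity.HubbardSuperconductivity.Theorems

open Matrix Finset Literature.Probability.LatticeModels Literature.MathematicalPhysics.QuantumLattice
  Literature.MathematicalPhysics.QuantumLattice.HubbardWave0
open scoped ComplexOrder

/-! ### The torus: `pairField g L` as a weighted bond pair field, and the `d`-wave bound -/

section Torus

variable {L : ℕ} [NeZero L]

/-- For `L ≥ 2`, every unit step `e ∈ {±e₁, ±e₂}` joins `x` to a NEIGHBOUR `x + e` on the
fermionic torus `(ℤ/Lℤ)²`. Friedli–Velenik (2017) §3.1. [folklore] -/
theorem fermionTorusGraph_adj_ofTorusSite_add (hL : 2 ≤ L) (x : TorusSite 2 L) {e : Site 2}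
    (he : e ∈ unitSteps) :
    (fermionTorusGraph 2 L).Adj (FermionTorus.ofTorusSite x)
      (FermionTorus.ofTorusSite (x + Torus.proj L e)) := by
  haveI : Fact (1 < L) := ⟨by omega⟩
  have h1 : (1 : ZMod L) ≠ 0 := one_ne_zero
  -- `Torus.proj` of a unit coordinate vector is the unit coordinate vector; `Torus.proj (-e) = -Torus.proj e`.
  have hps : ∀ i : Fin 2, Torus.proj (d := 2) L (Pi.single i 1) = Pi.single i 1 := by
    intro i; funext j
    by_cases h : j = i
    · subst h; simp [Torus.proj]
    · simp [Torus.proj, h]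
  have hpn : ∀ e : Site 2, Torus.proj (d := 2) L (-e) = -Torus.proj L e := by
    intro e; funext j; simp [Torus.proj]
  rw [fermionTorusGraph_adj, FermionTorus.toTorusSite_ofTorusSite,
    FermionTorus.toTorusSite_ofTorusSite, torusGraph_adj_iff]
  simp only [unitSteps, mem_insert, mem_singleton] at he
  have hne : Torus.proj (d := 2) L e ≠ 0 := by
    intro h0
    rcases he with rfl | rfl | rfl | rfl
    · exact h1 (by simpa [hps] using congrFun h0 0)
    · exact h1 (by simpa [hpn, hps] using congrFun h0 0)
    · exact h1 (by simpa [hps] using congrFun h0 1)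
    · exact h1 (by simpa [hpn, hps] using congrFun h0 1)
  refine ⟨fun h => hne (left_eq_add.mp h), ?_⟩
  rcases he with rfl | rfl | rfl | rfl
  · exact Or.inl ⟨0, by rw [hps]⟩
  · exact Or.inr ⟨0, by rw [hpn, hps, neg_add_cancel_right]⟩
  · exact Or.inl ⟨1, by rw [hps]⟩
  · exact Or.inr ⟨1, by rw [hpn, hps, neg_add_cancel_right]⟩

/-- On the torus of even side, every unit-step bond `(x, x + e)` joins opposite staggered signs.
Lieb, PRL 62 (1989) 1201 (bipartiteness). [folklore] -/
theorem torusStagger_ofTorusSite_add (hL : Even L) (x : TorusSite 2 L) {e : Site 2}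
    (he : e ∈ unitSteps) :
    torusStagger (FermionTorus.ofTorusSite (x + Torus.proj L e)) =
      -torusStagger (FermionTorus.ofTorusSite x) := by
  have hL2 : 2 ≤ L := by
    obtain ⟨k, hk⟩ := hL
    have := NeZero.ne L
    omega
  have h := torusStagger_eq_neg_of_adj_holds (d := 2) (L := L) hL
    (fermionTorusGraph_adj_ofTorusSite_add hL2 x he)
  rw [h, neg_neg]

/-- For a form factor with `g 0 = 0` (e.g. `dWaveFormFactor`, `extendedSWave`), the pair field
`Δ_g = pairField g L` is the weighted bond pair field over the bonds `(x, x + e)`, `e ∈ unitSteps`,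
with weights `g e/√2`. Scalapino, Phys. Rep. 250 (1995) 329, §2, eq. (2.2). [folklore] -/
theorem pairField_eq_weightedPair (g : Site 2 → ℝ) (hg : g 0 = 0) :
    pairField g L = ∑ p ∈ (Finset.univ : Finset (TorusSite 2 L)) ×ˢ unitSteps,
      ((g p.2 / Real.sqrt 2 : ℝ) : ℂ) •
        bondPairAnn (FermionTorus.ofTorusSite p.1) (FermionTorus.ofTorusSite (p.1 + Torus.proj L p.2)) := by
  rw [Finset.sum_product, pairField]
  refine Finset.sum_congr rfl fun x _ => ?_
  have h0 : (0 : Site 2) ∉ unitSteps := by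
    simp only [unitSteps, mem_insert, mem_singleton, not_or]
    refine ⟨fun h => ?_, fun h => ?_, fun h => ?_, fun h => ?_⟩
    · simpa using congrFun h 0
    · simpa using congrFun h 0
    · simpa using congrFun h 1
    · simpa using congrFun h 1
  rw [localPair, Finset.sum_insert h0, hg, zero_div, Complex.ofReal_zero, zero_smul, zero_add]
  rfl

/-- **The `g`-wave pseudospin bound on the torus** (soloist claim C32; N15 of the paper). On the
fermionic torus `(ℤ/Lℤ)²` of even side `L`, with the stagger `ε_x = (-1)^{x₁+x₂}`, let `ψ` be a
ground state of `hubbardTorus 2 L t U` in the sector `(N, S^z = S)` with `2 ≤ N ≤ L² + 2` and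
two-hole sector gap `E₀(N, S) - U < E₀(N - 2, S)`. Then for every form factor `g` with `g 0 = 0`
(e.g. `dWaveFormFactor`):
`Re ⟨ψ, Δ_g† Δ_g ψ⟩ ≤ ((L² + 2 - N)/4) · Re ⟨J_g ψ, J_g ψ⟩`, where
`J_g = Σ_x Σ_{e ∈ unitSteps} (g e/√2) ε_x j_{x,x+e}` is the staggered `g`-wave bond current
(`bondCurrent`). [cite: Zhang1990] -/
theorem re_expect_pairField_le_of_isGroundStateInSector (hL : Even L) (g : Site 2 → ℝ)
    (hg : g 0 = 0) (t U : ℝ) {N : ℕ} {S : ℝ} {ψ : Fock (Orb (FermionTorus 2 L))}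
    (hGS : IsGroundStateInSector (hubbardTorus 2 L t U) N S ψ) (hN : 2 ≤ N) (hNc : N ≤ L ^ 2 + 2)
    (hgap : (hubbardTorus 2 L t U).minEnergyOn (szSector N S) - U <
      (hubbardTorus 2 L t U).minEnergyOn (szSector (N - 2) S)) :
    (star ψ ⬝ᵥ (((pairField g L)ᴴ * pairField g L) *ᵥ ψ)).re ≤
      (((L : ℝ) ^ 2 + 2 - N) / 4) *
        (star ((∑ p ∈ (Finset.univ : Finset (TorusSite 2 L)) ×ˢ unitSteps,
            (((g p.2 / Real.sqrt 2 : ℝ) : ℂ) *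
                ((torusStagger (FermionTorus.ofTorusSite p.1) : ℤ) : ℂ)) •
              bondCurrent (FermionTorus.ofTorusSite p.1)
                (FermionTorus.ofTorusSite (p.1 + Torus.proj L p.2))) *ᵥ ψ) ⬝ᵥ
          ((∑ p ∈ (Finset.univ : Finset (TorusSite 2 L)) ×ˢ unitSteps,
            (((g p.2 / Real.sqrt 2 : ℝ) : ℂ) *
                ((torusStagger (FermionTorus.ofTorusSite p.1) : ℤ) : ℂ)) •
              bondCurrent (FermionTorus.ofTorusSite p.1)
                (FermionTorus.ofTorusSite (p.1 + Torus.proj L p.2))) *ᵥ ψ)).re := by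
  have hcard : Fintype.card (FermionTorus 2 L) = L ^ 2 := card_fermionTorus 2 L
  have hNc' : N ≤ Fintype.card (FermionTorus 2 L) + 2 := by rw [hcard]; exact hNc
  have h := re_norm_sq_weightedPair_le_of_isGroundStateInSector (fermionTorusGraph 2 L) torusStagger
    (fun x y hxy => torusStagger_eq_neg_of_adj_holds hL hxy) t U hGS hN hNc' hgap
    ((Finset.univ : Finset (TorusSite 2 L)) ×ˢ unitSteps)
    (fun p => (FermionTorus.ofTorusSite p.1, FermionTorus.ofTorusSite (p.1 + Torus.proj L p.2)))
    (fun p => ((g p.2 / Real.sqrt 2 : ℝ) : ℂ))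
    (fun p hp => torusStagger_ofTorusSite_add hL p.1 (Finset.mem_product.1 hp).2)
  have hΔ : star (pairField g L *ᵥ ψ) ⬝ᵥ (pairField g L *ᵥ ψ) =
      star ψ ⬝ᵥ (((pairField g L)ᴴ * pairField g L) *ᵥ ψ) :=
    star_mulVec_dotProduct_mulVec _ _ _
  rw [← pairField_eq_weightedPair g hg, hcard, Nat.cast_pow, hΔ] at h
  dsimp only at h
  exact h

end Torus

/-! ### The bound in the format of the summit statement -/

section SummitFormat

open Filter

/-- The term of side `L ≠ 0` of the sequence whose `liminf` the summit asks to be positive is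
`L⁻⁴ Re ⟨ψ_L, Δ_g† Δ_g ψ_L⟩` (`torusLROSeq_pairFieldCorr_succ`, restated for a side carrying a
`NeZero` instance). Scalapino, Phys. Rep. 250 (1995) 329, §2, eq. (2.4). [folklore] -/
theorem torusLROSeq_pairFieldCorr_eq (g : Site 2 → ℝ) (ψ : ∀ L, Fock (Orb (FermionTorus 2 L)))
    (L : ℕ) [NeZero L] :
    (∑ x ∈ halfOpenBox 2 L, ∑ y ∈ halfOpenBox 2 L, torusPullback (pairFieldCorr g ψ) L x y) /
        ((#(halfOpenBox 2 L) : ℝ)) ^ 2 =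
      (star (ψ L) ⬝ᵥ (((pairField g L)ᴴ * pairField g L) *ᵥ ψ L)).re / (L : ℝ) ^ 4 := by
  obtain ⟨n, rfl⟩ : ∃ n, L = n + 1 := ⟨L - 1, by have := NeZero.ne L; omega⟩
  exact torusLROSeq_pairFieldCorr_succ g ψ n

/-- Real-arithmetic step of the summit-format corollary: from `c/2 < A/L⁴`,
`A ≤ ((L² + 2 - N)/4) B`, `N ≥ (1-δ)L² - 2`, `δ ≤ 1`, `L ≥ 2`, `B ≥ 0` conclude `c L² ≤ B`. [folklore] -/
theorem mul_sq_le_of_lro_step {c δ L Nr A B : ℝ} (hδ0 : 0 ≤ δ) (hδ1 : δ ≤ 1)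
    (hL : 2 ≤ L) (hB : 0 ≤ B) (hNge : (1 - δ) * L ^ 2 - 2 ≤ Nr) (huk : c / 2 < A / L ^ 4)
    (hP : A ≤ ((L ^ 2 + 2 - Nr) / 4) * B) : c * L ^ 2 ≤ B := by
  have hL4 : 0 < L ^ 4 := by positivity
  have hL2 : 0 < L ^ 2 := by positivity
  have hA : c / 2 * L ^ 4 < A := (lt_div_iff₀ hL4).1 huk
  have hcoef : (L ^ 2 + 2 - Nr) / 4 ≤ (δ * L ^ 2 + 4) / 4 := by linarith
  have hA' : A ≤ ((δ * L ^ 2 + 4) / 4) * B := hP.trans (mul_le_mul_of_nonneg_right hcoef hB)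
  by_contra hlt
  have hlt' : B < c * L ^ 2 := not_le.1 hlt
  have hc : 0 < c := pos_of_mul_pos_left (hB.trans_lt hlt') hL2.le
  have hδL : 0 ≤ (δ * L ^ 2 + 4) / 4 := by positivity
  have h1 : ((δ * L ^ 2 + 4) / 4) * B ≤ ((δ * L ^ 2 + 4) / 4) * (c * L ^ 2) :=
    mul_le_mul_of_nonneg_left hlt'.le hδL
  have hL2' : 4 ≤ L ^ 2 := by nlinarith
  have h2 : ((δ * L ^ 2 + 4) / 4) * (c * L ^ 2) ≤ c / 2 * L ^ 4 := by
    have h3 : δ * L ^ 2 ≤ L ^ 2 := by nlinarith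
    nlinarith [mul_nonneg hc.le hL2.le]
  linarith

/-- **The pseudospin bound in the format of the summit `HubbardSuperconductivity`** (soloist
claim C32 / necessary condition N15). Let `0 < δ < 1`, a form factor `g` with `g 0 = 0` (the
summit: `g = dWaveFormFactor`), and `N`, `ψ` as in the summit's hypothesis — at every even side
`L`, `N L = 2⌊(1-δ)L²/2⌋`, `ψ L` normalised and a ground state of `hubbardTorus 2 L t U` in the
sector `(N L, S^z = 0)` — and assume in addition that for all large even `L` the two-hole sector
gap criterion `E₀(N_L, 0) - U < E₀(N_L - 2, 0)` holds (so the sector ground states are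
`η`-lowest-weight). If the summit's CONCLUSION holds for `g`, i.e. the `g`-wave pair field has
long-range order along the even sides, then the staggered `g`-wave bond current
`J_g = Σ_x Σ_{e ∈ unitSteps} (g e/√2) ε_x j_{x,x+e}` has fluctuations of order at least `L²`:
there is `c > 0` with `c · L² ≤ Re ⟨J_g ψ_L, J_g ψ_L⟩` for all large even `L` (one may take for
`c` the pair-order `liminf` itself). In words: a `d`-wave superconducting witness of the summit
whose sector ground states are `η`-lowest-weight must carry a non-vanishing `(π,π)` structure
factor `L⁻² ⟨J_d† J_d⟩ ≥ c` of the staggered `d`-current (orbital antiferromagnet / `d`-density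
wave operator). [cite: Zhang1990] -/
theorem eventually_sq_le_staggeredCurrent_of_pairField_lro {δ : ℝ} (hδ0 : 0 < δ) (hδ1 : δ < 1)
    (g : Site 2 → ℝ) (hg : g 0 = 0) (t U : ℝ) (N : ℕ → ℕ)
    (ψ : ∀ L, Fock (Orb (FermionTorus 2 L)))
    (hψ : ∀ L, Even L → N L = 2 * ⌊(1 - δ) * (L : ℝ) ^ 2 / 2⌋₊ ∧ star (ψ L) ⬝ᵥ ψ L = 1 ∧
      IsGroundStateInSector (hubbardTorus 2 L t U) (N L) 0 (ψ L))
    (hgap : ∀ᶠ L : ℕ in atTop, Even L →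
      (hubbardTorus 2 L t U).minEnergyOn (szSector (N L) 0) - U <
        (hubbardTorus 2 L t U).minEnergyOn (szSector (N L - 2) 0))
    (hLRO : HasLongRangeOrder (fun k => halfOpenBox 2 (2 * k))
      (fun k => torusPullback (pairFieldCorr g ψ) (2 * k))) :
    ∃ c : ℝ, 0 < c ∧ ∀ᶠ L : ℕ in atTop, Even L → ∀ [NeZero L],
      c * (L : ℝ) ^ 2 ≤
        (star ((∑ p ∈ (Finset.univ : Finset (TorusSite 2 L)) ×ˢ unitSteps,
            (((g p.2 / Real.sqrt 2 : ℝ) : ℂ) *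
                ((torusStagger (FermionTorus.ofTorusSite p.1) : ℤ) : ℂ)) •
              bondCurrent (FermionTorus.ofTorusSite p.1)
                (FermionTorus.ofTorusSite (p.1 + Torus.proj L p.2))) *ᵥ ψ L) ⬝ᵥ
          ((∑ p ∈ (Finset.univ : Finset (TorusSite 2 L)) ×ˢ unitSteps,
            (((g p.2 / Real.sqrt 2 : ℝ) : ℂ) *
                ((torusStagger (FermionTorus.ofTorusSite p.1) : ℤ) : ℂ)) •
              bondCurrent (FermionTorus.ofTorusSite p.1)
                (FermionTorus.ofTorusSite (p.1 + Torus.proj L p.2))) *ᵥ ψ L)).re := by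
  set u : ℕ → ℝ := fun k => (∑ x ∈ halfOpenBox 2 (2 * k), ∑ y ∈ halfOpenBox 2 (2 * k),
      torusPullback (pairFieldCorr g ψ) (2 * k) x y) / ((#(halfOpenBox 2 (2 * k)) : ℝ)) ^ 2 with hu
  have hpos : 0 < liminf u atTop := hLRO
  have hnonneg : ∀ k : ℕ, 1 ≤ k → 0 ≤ u k := by
    intro k hk
    haveI : NeZero (2 * k) := ⟨by omega⟩
    simp only [hu]
    rw [torusLROSeq_pairFieldCorr_eq g ψ (2 * k)]
    refine div_nonneg ?_ (by positivity)
    exact (posSemidef_conjTranspose_mul_self (pairField g (2 * k))).re_dotProduct_nonneg (ψ (2 * k))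
  have hbdd : IsBoundedUnder (· ≥ ·) atTop u :=
    isBoundedUnder_of_eventually_ge (a := 0)
      (Filter.eventually_atTop.2 ⟨1, fun k hk => hnonneg k hk⟩)
  have hev : ∀ᶠ k in atTop, liminf u atTop / 2 < u k :=
    Filter.eventually_lt_of_lt_liminf (by linarith) hbdd
  obtain ⟨K₁, hK₁⟩ := Filter.eventually_atTop.1 hev
  obtain ⟨K₂, hK₂⟩ := Filter.eventually_atTop.1 hgap
  refine ⟨liminf u atTop, hpos,
    Filter.eventually_atTop.2 ⟨max (2 * K₁) K₂ + ⌈1 / (1 - δ)⌉₊ + 2, ?_⟩⟩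
  intro L hL hEven inst
  obtain ⟨hN, -, hGS⟩ := hψ L hEven
  have hgapL := hK₂ L (by omega) hEven
  obtain ⟨k, hk⟩ := hEven
  have huk := hK₁ k (by omega)
  have e1 : 2 * k = L := by omega
  simp only [hu] at huk
  rw [e1, torusLROSeq_pairFieldCorr_eq g ψ L] at huk
  -- real bookkeeping on `L` and `N L`
  have hL2 : (2 : ℝ) ≤ L := by exact_mod_cast (show 2 ≤ L by omega)
  have hLδ : 1 / (1 - δ) ≤ (L : ℝ) :=
    (Nat.le_ceil _).trans (by exact_mod_cast (show ⌈1 / (1 - δ)⌉₊ ≤ L by omega))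
  have h1δ : (0 : ℝ) < 1 - δ := by linarith
  have hNle : (N L : ℝ) ≤ (1 - δ) * (L : ℝ) ^ 2 := by
    rw [hN]
    have hy : 0 ≤ (1 - δ) * (L : ℝ) ^ 2 / 2 := by positivity
    have hfl := Nat.floor_le hy
    push_cast
    linarith
  have hNge : (1 - δ) * (L : ℝ) ^ 2 - 2 ≤ (N L : ℝ) := by
    rw [hN]
    have hfl := Nat.lt_floor_add_one ((1 - δ) * (L : ℝ) ^ 2 / 2)
    push_cast
    linarith
  have hN2 : 2 ≤ N L := by
    have h1 : 1 ≤ (L : ℝ) * (1 - δ) := (div_le_iff₀ h1δ).1 hLδ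
    have h2 : (1 : ℝ) ≤ (1 - δ) * (L : ℝ) ^ 2 / 2 := by nlinarith
    have h3 : 1 ≤ ⌊(1 - δ) * (L : ℝ) ^ 2 / 2⌋₊ :=
      (Nat.le_floor_iff (by positivity)).2 (by exact_mod_cast h2)
    rw [hN]
    omega
  have hNc : N L ≤ L ^ 2 + 2 := by
    have h0 : (0 : ℝ) ≤ δ * (L : ℝ) ^ 2 := by positivity
    have : (N L : ℝ) ≤ (L : ℝ) ^ 2 + 2 := by nlinarith
    exact_mod_cast this
  have hP := re_expect_pairField_le_of_isGroundStateInSector (L := L) ⟨k, hk⟩ g hg t U hGS hN2 hNc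
    hgapL
  exact mul_sq_le_of_lro_step hδ0.le hδ1.le hL2 (EigenvalueContinuation.re_star_dotProduct_self_nonneg _) hNge huk hP

end SummitFormat

end Summit.HubbardSuperconductivity.HubbardSuperconductivity.Theorems
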